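import Summits.AtomisticToContinuum.Crystallization.Theorems.FreeSplittingCertificatesStrictSplittingRuleTorusParamModel442

/-!
# Corner certificate `Bpp` of the 4×4×2 box theorem (parity B, sign pattern `(+1,+1)`) — COMPUTATIONAL

Route `FreeSplittingCertificates`, crux `StrictSplittingRule` (stmt-AtomisticToContinuum-12560); unit b2b-freesplit-B (PART B, gen 3).
VALUE = a kernel-accepted (computational lane) certificate about a FINITE model — NOT summit progress.

`cornerBpp_nonneg : ∀ v, 0 ≤ evalQR (cornerB 1 1) v`: the corner term list of `…TorusParamModel442` (the symbolic 4×4×2 model's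
monomial pieces at the corner coefficients `c₀ + Δc₁ + Δc₂`, minus the enclosure-radius majorants `Σ ρ_k P⁺_k`, minus the fixed list
`E` = β-box majorant + `(1/30)‖u‖² − Π`) is a nonnegative form on `ℝ¹⁹⁵`: ONE `native_decide` of the trusted rounded-Gram predicate
`PSD.IsGramCertDD` on the 195×195 matrix assembled in Lean (`assemble`, proved = the Gram matrix) with the rounded `LDLᵀ` factor computed
in Lean (`certArrays 40 (1/1000)`), as in `…TorusModel442A`.  Axiom `Lean.ofReduceBool` (computational regime).  [folklore]
-/

namespace Summit.AtomisticToContinuum.Crystallization.Theorems.StrictSplittingRuleTorusLMI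

namespace Param442

open Literature.Computation.Certificates

/-- The symmetrised Gram matrix of the corner form. [folklore] -/
def matBpp : Matrix (Fin 195) (Fin 195) ℚ := symm (assemble (cornerB (1) (1))).toMatrix
/-- Its rounded `LDLᵀ` factor (shift `10⁻³`, 40 bits), computed in Lean. [folklore] -/
def factBpp : Array ℚ × Array (Array ℚ) := certArrays 40 (1 / 1000) matBpp

/-- **Certificate**: `matBpp ⪰ 0` by the trusted rounded-Gram check. COMPUTATIONAL (`native_decide`). [folklore] -/
theorem certBpp_valid : PSD.IsGramCertDD matBpp (vecOfArray 195 factBpp.1) (matrixOfArrays 195 195 factBpp.2) := by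
  native_decide

/-- **Corner (+1,+1), parity B: the corner form is nonnegative on every real field.** [folklore] -/
theorem cornerBpp_nonneg (v : Fin 195 → ℝ) : 0 ≤ evalQR (cornerB (1) (1)) v :=
  evalQR_nonneg_of_certDD (ts := cornerB (1) (1)) rfl certBpp_valid v

end Param442

end Summit.AtomisticToContinuum.Crystallization.Theorems.StrictSplittingRuleTorusLMI
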